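import Summits.AtomisticToContinuum.Crystallization.Theses.ReggeStarCoercivity
import Literature.Geometry.DiscreteGeometry.KissingRigidity
import Literature.Barriers.AtomisticToContinuum.IcosahedralClusters

/-!
# Negative knowledge for crux `DefectFreeCrystallizes` — TYPE GAP of the 1/20-defect predicate

No finite displacement set is `1/20`-close to the fcc kissing pattern at one admissible scale and to
the hcp kissing pattern at another (`not_fccClose_and_hcpClose`): the TYPE of a good site in the
hypothesis `ZeroDefectDensity` of `ReggeStarCoercivity.DefectFreeCrystallizes` is well defined.
Proof: centrosymmetry of the cuboctahedron versus the point `p⋆ = (-1,-1,-4)/(3√2)` of the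
anticuboctahedron, whose antipode is at distance `1/√3` from the pattern (integer arithmetic).
Supports item stmt-AtomisticToContinuum-13603 (standing disprover, cycle 2).
-/

noncomputable section

namespace Summit.AtomisticToContinuum.Crystallization.Theorems.DefectFreeCrystallizes.Negative.TypeGap

open Literature.Geometry.DiscreteGeometry

/-- The integer fcc model is closed under negation. [folklore] -/
theorem fccInt_neg_mem : ∀ v ∈ fccInt, -v ∈ fccInt := by decide

/-- `intVec` commutes with negation. [folklore] -/
theorem intVec_neg (v : Fin 3 → ℤ) : intVec (-v) = -intVec v := by
  ext i; simp [intVec]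

/-- The fcc kissing pattern (cuboctahedron) is centrosymmetric. [folklore] -/
theorem neg_mem_fccKissingPattern {p : EuclideanSpace ℝ (Fin 3)} (hp : p ∈ fccKissingPattern) : -p ∈ fccKissingPattern := by
  unfold fccKissingPattern scaledPattern at *
  obtain ⟨v, hv, rfl⟩ := Finset.mem_image.1 hp
  exact Finset.mem_image.2 ⟨-v, fccInt_neg_mem v hv, by rw [intVec_neg, smul_neg]⟩

/-- `(-1,-1,-4)` is one of the twelve hcp integer vectors. [folklore] -/
theorem hcpStar_mem : (![-1, -1, -4] : Fin 3 → ℤ) ∈ hcpInt := by decide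

/-- Every hcp integer vector is at squared distance `≥ 6` from `-(−1,−1,−4)`. [folklore] -/
theorem six_le_sqNormInt_add_hcpStar : ∀ v ∈ hcpInt, (6 : ℤ) ≤ sqNormInt (v + (![-1, -1, -4] : Fin 3 → ℤ)) := by decide

/-- `p⋆` belongs to the hcp kissing pattern. [folklore] -/
theorem pStar_mem : ((Real.sqrt (18 : ℕ))⁻¹ • intVec (![-1, -1, -4] : Fin 3 → ℤ) : EuclideanSpace ℝ (Fin 3)) ∈ hcpKissingPattern :=
  Finset.mem_image.2 ⟨(![-1, -1, -4] : Fin 3 → ℤ), hcpStar_mem, rfl⟩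

/-- The anticuboctahedron is NOT centrosymmetric, quantitatively: every point of the hcp pattern is
at distance `> 11/20` (in fact `≥ 1/√3`) from `-p⋆`. [folklore] -/
theorem norm_add_pStar_gt {q : EuclideanSpace ℝ (Fin 3)} (hq : q ∈ hcpKissingPattern) : 11 / 20 < ‖q + ((Real.sqrt (18 : ℕ))⁻¹ • intVec (![-1, -1, -4] : Fin 3 → ℤ) : EuclideanSpace ℝ (Fin 3))‖ := by
  obtain ⟨v, hv, rfl⟩ := Finset.mem_image.1 hq
  have h18 : (0 : ℝ) < Real.sqrt (18 : ℕ) := by positivity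
  have hsq : ‖((Real.sqrt (18 : ℕ))⁻¹ • intVec v : EuclideanSpace ℝ (Fin 3)) + ((Real.sqrt (18 : ℕ))⁻¹ • intVec (![-1, -1, -4] : Fin 3 → ℤ) : EuclideanSpace ℝ (Fin 3))‖ ^ 2 = (sqNormInt (v + (![-1, -1, -4] : Fin 3 → ℤ)) : ℝ) / 18 := by
    rw [← smul_add, ← intVec_add, norm_smul, norm_inv, Real.norm_of_nonneg h18.le, norm_intVec,
      mul_pow, inv_pow, Real.sq_sqrt (by positivity), Real.sq_sqrt (Literature.Barriers.AtomisticToContinuum.sqNormInt_nonneg _)]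
    push_cast; ring
  have h6 : (6 : ℝ) ≤ (sqNormInt (v + (![-1, -1, -4] : Fin 3 → ℤ)) : ℝ) := by exact_mod_cast six_le_sqNormInt_add_hcpStar v hv
  by_contra hlt
  have hle := le_of_not_gt hlt
  have := pow_le_pow_left₀ (norm_nonneg _) hle 2
  rw [hsq] at this
  nlinarith

/-- Centrosymmetry transfers to matched shells: in a shell `η`-matched to an image of the fcc pattern
every point has a near-antipode. [folklore] -/
theorem exists_near_neg_of_etaMatched_fcc {η : ℝ} {T : Finset (EuclideanSpace ℝ (Fin 3))} {A : EuclideanSpace ℝ (Fin 3) →ₗᵢ[ℝ] EuclideanSpace ℝ (Fin 3)}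
    (h : EtaMatched η T (fccKissingPattern.image A)) {t : EuclideanSpace ℝ (Fin 3)} (ht : t ∈ T) :
    ∃ t' ∈ T, ‖t + t'‖ ≤ 2 * η := by
  obtain ⟨e, he⟩ := h
  obtain ⟨p, hp, hpe⟩ := Finset.mem_image.1 (e ⟨t, ht⟩).2
  have hneg : A (-p) ∈ fccKissingPattern.image A :=
    Finset.mem_image_of_mem _ (neg_mem_fccKissingPattern hp)
  have h1 : ‖t - A p‖ ≤ η := by
    have := he ⟨t, ht⟩
    rwa [dist_eq_norm, ← hpe] at this
  have hmemT : ((e.symm ⟨A (-p), hneg⟩ : T) : EuclideanSpace ℝ (Fin 3)) ∈ T := (e.symm ⟨A (-p), hneg⟩).2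
  have h2 : dist ((e.symm ⟨A (-p), hneg⟩ : T) : EuclideanSpace ℝ (Fin 3)) (A (-p)) ≤ η := by
    have := he (e.symm ⟨A (-p), hneg⟩)
    rwa [Equiv.apply_symm_apply] at this
  generalize ((e.symm ⟨A (-p), hneg⟩ : T) : EuclideanSpace ℝ (Fin 3)) = u at hmemT h2
  refine ⟨u, hmemT, ?_⟩
  rw [dist_eq_norm, map_neg, sub_neg_eq_add] at h2
  calc ‖t + u‖ = ‖(t - A p) + (u + A p)‖ := by abel_nf
    _ ≤ ‖t - A p‖ + ‖u + A p‖ := norm_add_le _ _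
    _ ≤ 2 * η := by linarith

/-- Non-centrosymmetry transfers too: a shell `η`-matched to an image of the hcp pattern contains a
point `t₀` all of whose "antipodal sums" are `≥ 11/20 - 2η`. [folklore] -/
theorem exists_far_neg_of_etaMatched_hcp {η : ℝ} {T : Finset (EuclideanSpace ℝ (Fin 3))} {A : EuclideanSpace ℝ (Fin 3) →ₗᵢ[ℝ] EuclideanSpace ℝ (Fin 3)}
    (h : EtaMatched η T (hcpKissingPattern.image A)) :
    ∃ t₀ ∈ T, ∀ t ∈ T, 11 / 20 - 2 * η ≤ ‖t + t₀‖ := by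
  obtain ⟨e, he⟩ := h
  have hmem : A ((Real.sqrt (18 : ℕ))⁻¹ • intVec (![-1, -1, -4] : Fin 3 → ℤ) : EuclideanSpace ℝ (Fin 3)) ∈ hcpKissingPattern.image A := Finset.mem_image_of_mem _ pStar_mem
  have hmemT : ((e.symm ⟨A ((Real.sqrt (18 : ℕ))⁻¹ • intVec (![-1, -1, -4] : Fin 3 → ℤ) : EuclideanSpace ℝ (Fin 3)), hmem⟩ : T) : EuclideanSpace ℝ (Fin 3)) ∈ T := (e.symm ⟨A ((Real.sqrt (18 : ℕ))⁻¹ • intVec (![-1, -1, -4] : Fin 3 → ℤ) : EuclideanSpace ℝ (Fin 3)), hmem⟩).2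
  have h2 : dist ((e.symm ⟨A ((Real.sqrt (18 : ℕ))⁻¹ • intVec (![-1, -1, -4] : Fin 3 → ℤ) : EuclideanSpace ℝ (Fin 3)), hmem⟩ : T) : EuclideanSpace ℝ (Fin 3)) (A ((Real.sqrt (18 : ℕ))⁻¹ • intVec (![-1, -1, -4] : Fin 3 → ℤ) : EuclideanSpace ℝ (Fin 3))) ≤ η := by
    have := he (e.symm ⟨A ((Real.sqrt (18 : ℕ))⁻¹ • intVec (![-1, -1, -4] : Fin 3 → ℤ) : EuclideanSpace ℝ (Fin 3)), hmem⟩)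
    rwa [Equiv.apply_symm_apply] at this
  generalize ((e.symm ⟨A ((Real.sqrt (18 : ℕ))⁻¹ • intVec (![-1, -1, -4] : Fin 3 → ℤ) : EuclideanSpace ℝ (Fin 3)), hmem⟩ : T) : EuclideanSpace ℝ (Fin 3)) = u at hmemT h2
  rw [dist_eq_norm] at h2
  refine ⟨u, hmemT, fun t ht => ?_⟩
  obtain ⟨q, hq, hqe⟩ := Finset.mem_image.1 (e ⟨t, ht⟩).2
  have h1 : ‖t - A q‖ ≤ η := by
    have := he ⟨t, ht⟩
    rwa [dist_eq_norm, ← hqe] at this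
  have h3 : 11 / 20 < ‖A q + A ((Real.sqrt (18 : ℕ))⁻¹ • intVec (![-1, -1, -4] : Fin 3 → ℤ) : EuclideanSpace ℝ (Fin 3))‖ := by rw [← map_add, A.norm_map]; exact norm_add_pStar_gt hq
  have h4 : ‖A q + A ((Real.sqrt (18 : ℕ))⁻¹ • intVec (![-1, -1, -4] : Fin 3 → ℤ) : EuclideanSpace ℝ (Fin 3))‖ ≤ ‖t + u‖ + ‖t - A q‖ + ‖u - A ((Real.sqrt (18 : ℕ))⁻¹ • intVec (![-1, -1, -4] : Fin 3 → ℤ) : EuclideanSpace ℝ (Fin 3))‖ := by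
    calc ‖A q + A ((Real.sqrt (18 : ℕ))⁻¹ • intVec (![-1, -1, -4] : Fin 3 → ℤ) : EuclideanSpace ℝ (Fin 3))‖ = ‖(t + u) - (t - A q) - (u - A ((Real.sqrt (18 : ℕ))⁻¹ • intVec (![-1, -1, -4] : Fin 3 → ℤ) : EuclideanSpace ℝ (Fin 3)))‖ := by abel_nf
      _ ≤ ‖(t + u) - (t - A q)‖ + ‖u - A ((Real.sqrt (18 : ℕ))⁻¹ • intVec (![-1, -1, -4] : Fin 3 → ℤ) : EuclideanSpace ℝ (Fin 3))‖ := norm_sub_le _ _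
      _ ≤ ‖t + u‖ + ‖t - A q‖ + ‖u - A ((Real.sqrt (18 : ℕ))⁻¹ • intVec (![-1, -1, -4] : Fin 3 → ℤ) : EuclideanSpace ℝ (Fin 3))‖ := by
        linarith [norm_sub_le (t + u) (t - A q)]
  linarith

/-- **Type gap.** No finite set of displacement vectors is `1/20`-close to the fcc pattern at one
admissible scale AND `1/20`-close to the hcp pattern at another admissible scale. [folklore] -/
theorem not_fccClose_and_hcpClose {S : Finset (EuclideanSpace ℝ (Fin 3))} {a a' : ℝ} (ha : 9 / 10 ≤ a) (ha' : a ≤ 11 / 10)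
    (hb : 9 / 10 ≤ a')
    (h₁ : ShellCloseTo (1 / 20) (S.image fun v => a⁻¹ • v) fccKissingPattern)
    (h₂ : ShellCloseTo (1 / 20) (S.image fun v => a'⁻¹ • v) hcpKissingPattern) : False := by
  have ha0 : 0 < a := by linarith
  have hb0 : 0 < a' := by linarith
  obtain ⟨A, hA⟩ := h₁
  obtain ⟨A', hA'⟩ := h₂
  obtain ⟨t₀, ht₀, hfar⟩ := exists_far_neg_of_etaMatched_hcp hA'
  obtain ⟨s₀, hs₀, rfl⟩ := Finset.mem_image.1 ht₀
  -- near-antipode of `a⁻¹ • s₀` in the fcc-matched copy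
  obtain ⟨t', ht', hnear⟩ :=
    exists_near_neg_of_etaMatched_fcc hA (Finset.mem_image_of_mem (fun v => a⁻¹ • v) hs₀)
  obtain ⟨s₁, hs₁, rfl⟩ := Finset.mem_image.1 ht'
  -- upper bound `‖s₀ + s₁‖ ≤ a/10`
  have hup : ‖s₀ + s₁‖ ≤ a / 10 := by
    have : ‖(a⁻¹ • (s₀ + s₁) : EuclideanSpace ℝ (Fin 3))‖ ≤ 2 * (1 / 20) := by rwa [smul_add]
    rw [norm_smul, norm_inv, Real.norm_of_nonneg ha0.le] at this
    rw [inv_mul_le_iff₀ ha0] at this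
    linarith
  -- lower bound `9 a'/20 ≤ ‖s₀ + s₁‖` from the hcp-matched copy at `t = a'⁻¹ • s₁`
  have hlow : 9 / 20 * a' ≤ ‖s₀ + s₁‖ := by
    have := hfar (a'⁻¹ • s₁) (Finset.mem_image_of_mem (fun v => a'⁻¹ • v) hs₁)
    rw [← smul_add, norm_smul, norm_inv, Real.norm_of_nonneg hb0.le, add_comm s₁] at this
    rw [le_inv_mul_iff₀ hb0] at this
    linarith
  linarith


end Summit.AtomisticToContinuum.Crystallization.Theorems.DefectFreeCrystallizes.Negative.TypeGap

end
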